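import Summits.ValiantsHypothesis.ValiantsHypothesis.Theses.BorderApolarity
import Summits.ValiantsHypothesis.ValiantsHypothesis.Theorems.BorderApolarityGctBridge

/-!
# `BorderApolarity.GctBridge` (item `stmt-ValiantsHypothesis-0983`) — by-name wrapper

Thin wrapper stating the closing theorem of `Theorems/BorderApolarityGctBridge.lean`
(`gctBridge_proof`, typed against the item's signature verbatim so that every route sharing the
item can link it) against the route decl
`Summit.ValiantsHypothesis.ValiantsHypothesis.Theses.BorderApolarity.GctBridge` BY NAME, for the
gate's by-name close probe. (This module imports the Theses file, so the route file links the
Theses-free `gctBridge_proof`, not this wrapper.)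
-/

namespace Summit.ValiantsHypothesis.ValiantsHypothesis.Theorems.BorderApolarityGctBridge

/-- **`BorderApolarity.GctBridge` holds** (item `stmt-ValiantsHypothesis-0983`): the
quasi-polynomial Mulmuley–Sohoni thesis implies Valiant's hypothesis — by `gctBridge_proof`
(inline `gct_assembly` glue over discharged facts + the hub lemma). [folklore] -/
theorem gctBridge_route_proof :
    Summit.ValiantsHypothesis.ValiantsHypothesis.Theses.BorderApolarity.GctBridge :=
  gctBridge_proof

end Summit.ValiantsHypothesis.ValiantsHypothesis.Theorems.BorderApolarityGctBridge
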